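import Summits.BirchSwinnertonDyer.BirchSwinnertonDyer.Theorems.PrintCf2SplitBadTwoKatzMeasureValueExists
import HarnessLib

/-!
# stub-ideation k3 g20 — «THE MOD-𝔪 GHOST OF THE CENTRAL ZERO»
# crux `PrintCf2.SplitBadTwoLowerHalfOfFacts` (stmt-BirchSwinnertonDyer-27851), stub `stub_heegnerIndexLowerAtTwo`

Seat `sidea-stub_heegnerIndexLowerAtTwo-3` g20 (planner, TECHNIQUE = decomposition with a provable glue).
HONEST FRAMING: nothing here closes the crux or the registered stub; BSD is NOT proved by any of this; no
`sorry`; Mathlib + the tree's `IntSeries.HasValueAt₂` API only.  This file is the typed sketch attached to the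
idea card `Ideas/stub-heegnerindexloweratwo-k3-g20.md`.

THE STEP.  STUB-PLAN v4.1 §3 (x): below the shared nodes S3a⁻ (⊆), ALG₀ and (a-∃) = ρ1′ (`e_A ≡ α` key-free),
LOWER on all six dyadic keys is ONE integer condition `α ≥ −1`; `α ≤ 0` is a theorem mod ⊆.  At the in-tree
`BSD₂`-exact anchor `W₀ = cm7^(−1)` (N = 784, Miller; `A₀ = 0`, `g₀ = v₂Tam − 2v₂tors + 2ℓ₀ = 3 − 2 + 0 = 1`)
the member law reads `‖val₀‖² = 2^{−m₀}`, `m₀ = 2(A₀+g₀) + α = 2 + α`, so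

  `α ≥ −1  ⟺  m₀ ≥ 1  ⟺  ‖val₀‖ < 1`  =: GHOST (one bit: the Katz–Rubin value at the anchor is a NON-UNIT).

GHOST is produced WITHOUT digits, WITHOUT ⊇, WITHOUT `XRegularAtTwo`, by the mod-𝔪 collapse of integral power
series (§A: every interior value of `G ∈ 𝒪⟦T₁,T₂⟧` is congruent to the constant term mod 𝔪) from EITHER
 (Gα) the anchor's own central zero `L(cm7^(−1), 1) = 0`, which is the value of the ω_K-SIBLING branch
      (`λ♭ = λ·ω_K`, congruent to `λ`'s branch mod 2 because `ω_K ≡ 1 (mod 2)` and de Shalit's `μ(𝔣)` is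
      `𝐃`-valued) at a 𝔭-ramified in-range point — §B `SiblingGhost`; or
 (Gβ) ONE in-range (𝔭-unramified, typed-range) value of the anchor's own branch, e.g. at `ε = ψ₄₉⁻¹`
      (type (−1,0)): `(π/π̄)²·L(49a1,1)/Ω` — §B `InRangeGhost`.
 (Gγ) KUMMER SHADOW (§A′): an integral series is 1-Lipschitz on the closed bidisc, so ONE typed in-range point
      at distance `< 2^{−n′₀} = 1/2` from the Rubin point (types differing by EVEN integers are `1/8`-close,
      §D `norm_pow_two_mul_sub_one_le`) has `‖v‖ = ‖val₀‖` EXACTLY (CONT⁻ supplies `‖val₀‖ ≥ 1/2`): the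
      `α`-AUDIT relocated in range, `α = 2·v₂(v) − 2` (§C `alpha_eq_of_shadow`).
§C is the ℤ/ℝ glue (GHOST ⟹ α ≥ −1 ⟹ LOWER on every member, in the LEAD's zpow and in row 57's rpow
currency; with PARITY `‖val₀‖ ∈ 2^ℤ` or the shadow digit also `α = 0`, i.e. `η₀ = 0`, FALLBACK 0′'s input,
for free).  §D: 2-adic bricks (`ℓ₀ = 0` at the anchor: odd valuation ⟹ non-square; even-shift depth `u^{2a} ≡ 1 (8)`).
References: [deShalit1987] II.4.12 (31), II.4.14 (36)–(37), II.4.16 (49)–(50), III.1.1 (𝐃-valued Λ);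
[Miller2011] Thm 7.1; [Rubin1992]; [Washington1997] §7.2.
-/

noncomputable section

open scoped Classical

set_option linter.dupNamespace false
set_option autoImplicit false

open Literature.NumberTheory.EllipticCurves
open Summit.BirchSwinnertonDyer.BirchSwinnertonDyer.Theorems.PrintCf2.KatzMeasureValue

namespace Summit.BirchSwinnertonDyer.BirchSwinnertonDyer.Cruxes.SplitBadTwoLowerHalfOfFacts.GhostZeroK3G20

/-! ### §A  MOD-𝔪 COLLAPSE: an interior value of an integral series is congruent to the constant term -/

section Collapse

variable {p : ℕ} [Fact p.Prime]

/-- The constant term `[T₁⁰T₂⁰]G ∈ 𝒪_{ℂ_p}` read in `ℂ_p`. -/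
def constTerm (G : PowerSeries (PowerSeries (PadicComplexInt p))) : ℂ_[p] :=
  ((PowerSeries.coeff 0 (PowerSeries.coeff 0 G) : PadicComplexInt p) : ℂ_[p])

theorem norm_constTerm_le_one (G : PowerSeries (PowerSeries (PadicComplexInt p))) : ‖constTerm G‖ ≤ 1 :=
  norm_coe_padicComplexInt_le_one _

variable {G : PowerSeries (PowerSeries (PadicComplexInt p))}

/-- **COLLAPSE.** For `‖x‖, ‖y‖ < 1`: `‖G(x,y) − G(0,0)‖ ≤ max ‖x‖ ‖y‖` (ultrametric tail bound). -/
theorem norm_sub_constTerm_le {x y v : ℂ_[p]} (h : IntSeries.HasValueAt₂ G x y v) (hx : ‖x‖ < 1)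
    (hy : ‖y‖ < 1) : ‖v - constTerm G‖ ≤ max ‖x‖ ‖y‖ := by
  set f : ℕ × ℕ → ℂ_[p] := fun k ↦
    ((PowerSeries.coeff k.2 (PowerSeries.coeff k.1 G) : PadicComplexInt p) : ℂ_[p]) * x ^ k.1 * y ^ k.2
    with hf
  have hs : Summable f := h.summable
  have hv : v = ∑' k, f k := h.tsum_eq.symm
  have hsplit := hs.tsum_eq_add_tsum_ite ((0, 0) : ℕ × ℕ)
  have h00 : f (0, 0) = constTerm G := by simp [hf, constTerm]
  have hdiff : v - constTerm G = ∑' k, (if k = ((0, 0) : ℕ × ℕ) then 0 else f k) := by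
    rw [hv, hsplit, h00, add_sub_cancel_left]
  rw [hdiff]
  refine IsUltrametricDist.norm_tsum_le_of_forall_le_of_nonneg (le_max_of_le_left (norm_nonneg x)) ?_
  intro k
  split_ifs with hk
  · rw [norm_zero]
    exact le_max_of_le_left (norm_nonneg x)
  · refine (norm_term₂_le G x y k).trans ?_
    rcases Nat.eq_zero_or_pos k.1 with h1 | h1
    · have h2 : k.2 ≠ 0 := by
        intro h2
        exact hk (Prod.ext h1 h2)
      calc ‖x‖ ^ k.1 * ‖y‖ ^ k.2 ≤ 1 * ‖y‖ :=
            mul_le_mul (pow_le_one₀ (norm_nonneg _) hx.le) (pow_le_of_le_one (norm_nonneg _) hy.le h2)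
              (pow_nonneg (norm_nonneg _) _) zero_le_one
        _ ≤ max ‖x‖ ‖y‖ := by rw [one_mul]; exact le_max_right _ _
    · calc ‖x‖ ^ k.1 * ‖y‖ ^ k.2 ≤ ‖x‖ * 1 :=
            mul_le_mul (pow_le_of_le_one (norm_nonneg _) hx.le h1.ne') (pow_le_one₀ (norm_nonneg _) hy.le)
              (pow_nonneg (norm_nonneg _) _) (norm_nonneg _)
        _ ≤ max ‖x‖ ‖y‖ := by rw [mul_one]; exact le_max_left _ _

/-- `‖G(x,y) − G(0,0)‖ < 1` on the open bidisc. -/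
theorem norm_sub_constTerm_lt_one {x y v : ℂ_[p]} (h : IntSeries.HasValueAt₂ G x y v) (hx : ‖x‖ < 1)
    (hy : ‖y‖ < 1) : ‖v - constTerm G‖ < 1 :=
  (norm_sub_constTerm_le h hx hy).trans_lt (max_lt hx hy)

/-- **The unit/non-unit bit of an interior value is the bit of the constant term.** -/
theorem norm_lt_one_iff_constTerm {x y v : ℂ_[p]} (h : IntSeries.HasValueAt₂ G x y v) (hx : ‖x‖ < 1)
    (hy : ‖y‖ < 1) : ‖v‖ < 1 ↔ ‖constTerm G‖ < 1 := by
  have hd := norm_sub_constTerm_lt_one h hx hy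
  constructor
  · intro hv
    have : constTerm G = v + (constTerm G - v) := by ring
    rw [this]
    exact (IsUltrametricDist.norm_add_le_max _ _).trans_lt (max_lt hv (by rwa [norm_sub_rev]))
  · intro hc
    have : v = (v - constTerm G) + constTerm G := by ring
    rw [this]
    exact (IsUltrametricDist.norm_add_le_max _ _).trans_lt (max_lt hd hc)

/-- An interior ZERO makes the constant term a non-unit. -/
theorem norm_constTerm_lt_one_of_zero {x y : ℂ_[p]} (h : IntSeries.HasValueAt₂ G x y 0) (hx : ‖x‖ < 1)
    (hy : ‖y‖ < 1) : ‖constTerm G‖ < 1 :=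
  (norm_lt_one_iff_constTerm h hx hy).1 (by simp)

/-- **Two interior values of one integral series are units together or non-units together.** -/
theorem norm_lt_one_iff_of_two_points {x y v x' y' v' : ℂ_[p]} (h : IntSeries.HasValueAt₂ G x y v)
    (hx : ‖x‖ < 1) (hy : ‖y‖ < 1) (h' : IntSeries.HasValueAt₂ G x' y' v') (hx' : ‖x'‖ < 1) (hy' : ‖y'‖ < 1) :
    ‖v‖ < 1 ↔ ‖v'‖ < 1 :=
  (norm_lt_one_iff_constTerm h hx hy).trans (norm_lt_one_iff_constTerm h' hx' hy').symm

/-- **Frame transfer.** Two series sharing ONE interior value (e.g. two satisfiers of the same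
`IsKatzMeasure₂` frame at one typed in-range point) have the same constant-term bit — no identity principle
needed. -/
theorem norm_constTerm_lt_one_of_shared_value {G' : PowerSeries (PowerSeries (PadicComplexInt p))}
    {x y v : ℂ_[p]} (h : IntSeries.HasValueAt₂ G x y v) (h' : IntSeries.HasValueAt₂ G' x y v) (hx : ‖x‖ < 1)
    (hy : ‖y‖ < 1) (hG' : ‖constTerm G'‖ < 1) : ‖constTerm G‖ < 1 :=
  (norm_lt_one_iff_constTerm h hx hy).1 ((norm_lt_one_iff_constTerm h' hx hy).2 hG')

/-! #### §A′  LIPSCHITZ / KUMMER SHADOW: two points of ONE integral series that are close have close values -/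

/-- `‖xᵏ − x′ᵏ‖ ≤ ‖x − x′‖` on the closed unit disc (ultrametric). -/
theorem norm_pow_sub_pow_le {x x' : ℂ_[p]} (hx : ‖x‖ ≤ 1) (hx' : ‖x'‖ ≤ 1) (k : ℕ) :
    ‖x ^ k - x' ^ k‖ ≤ ‖x - x'‖ := by
  have h := (Commute.all x x').geom_sum₂_mul k
  rw [← h, norm_mul]
  calc ‖∑ i ∈ Finset.range k, x ^ i * x' ^ (k - 1 - i)‖ * ‖x - x'‖ ≤ 1 * ‖x - x'‖ := by
        refine mul_le_mul_of_nonneg_right ?_ (norm_nonneg _)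
        refine IsUltrametricDist.norm_sum_le_of_forall_le_of_nonneg zero_le_one (fun i _ ↦ ?_)
        rw [norm_mul, norm_pow, norm_pow]
        exact mul_le_one₀ (pow_le_one₀ (norm_nonneg _) hx) (pow_nonneg (norm_nonneg _) _)
          (pow_le_one₀ (norm_nonneg _) hx')
    _ = ‖x - x'‖ := one_mul _

/-- **LIPSCHITZ.** `‖G(x,y) − G(x′,y′)‖ ≤ max ‖x − x′‖ ‖y − y′‖` for an integral series and points of the
closed unit bidisc (where the two values exist). -/
theorem norm_sub_le_of_two_points {x y v x' y' v' : ℂ_[p]} (h : IntSeries.HasValueAt₂ G x y v)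
    (h' : IntSeries.HasValueAt₂ G x' y' v') (hx : ‖x‖ ≤ 1) (hy : ‖y‖ ≤ 1) (hx' : ‖x'‖ ≤ 1)
    (hy' : ‖y'‖ ≤ 1) : ‖v - v'‖ ≤ max ‖x - x'‖ ‖y - y'‖ := by
  have hs := h.sub h'
  rw [← hs.tsum_eq]
  refine IsUltrametricDist.norm_tsum_le_of_forall_le_of_nonneg (le_max_of_le_left (norm_nonneg _)) ?_
  intro k
  have e : ((PowerSeries.coeff k.2 (PowerSeries.coeff k.1 G) : PadicComplexInt p) : ℂ_[p]) * x ^ k.1 *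
        y ^ k.2 - ((PowerSeries.coeff k.2 (PowerSeries.coeff k.1 G) : PadicComplexInt p) : ℂ_[p]) *
        x' ^ k.1 * y' ^ k.2 =
      ((PowerSeries.coeff k.2 (PowerSeries.coeff k.1 G) : PadicComplexInt p) : ℂ_[p]) *
        ((x ^ k.1 - x' ^ k.1) * y ^ k.2 + x' ^ k.1 * (y ^ k.2 - y' ^ k.2)) := by ring
  rw [e, norm_mul]
  calc _ ≤ 1 * max ‖x - x'‖ ‖y - y'‖ := by
        refine mul_le_mul (norm_coe_padicComplexInt_le_one _) ?_ (norm_nonneg _) zero_le_one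
        refine (IsUltrametricDist.norm_add_le_max _ _).trans (max_le_max ?_ ?_)
        · rw [norm_mul, norm_pow]
          calc ‖x ^ k.1 - x' ^ k.1‖ * ‖y‖ ^ k.2 ≤ ‖x - x'‖ * 1 :=
                mul_le_mul (norm_pow_sub_pow_le hx hx' _) (pow_le_one₀ (norm_nonneg _) hy)
                  (pow_nonneg (norm_nonneg _) _) (norm_nonneg _)
            _ = ‖x - x'‖ := mul_one _
        · rw [norm_mul, norm_pow]
          calc ‖x'‖ ^ k.1 * ‖y ^ k.2 - y' ^ k.2‖ ≤ 1 * ‖y - y'‖ :=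
                mul_le_mul (pow_le_one₀ (norm_nonneg _) hx') (norm_pow_sub_pow_le hy hy' _) (norm_nonneg _)
                  zero_le_one
            _ = ‖y - y'‖ := one_mul _
    _ = max ‖x - x'‖ ‖y - y'‖ := one_mul _

/-- **ISOSCELES.** `‖v − v′‖ < ‖v‖ ⟹ ‖v′‖ = ‖v‖`. -/
theorem norm_eq_of_norm_sub_lt {v v' : ℂ_[p]} (h : ‖v - v'‖ < ‖v‖) : ‖v'‖ = ‖v‖ := by
  apply le_antisymm
  · have e : v' = v + -(v - v') := by ring
    rw [e]
    refine (IsUltrametricDist.norm_add_le_max _ _).trans ?_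
    rw [norm_neg]
    exact max_le le_rfl h.le
  · by_contra hle
    have hlt : ‖v'‖ < ‖v‖ := lt_of_not_ge hle
    have e : v = v' + (v - v') := by ring
    have h2 : ‖v‖ ≤ max ‖v'‖ ‖v - v'‖ := by
      conv_lhs => rw [e]
      exact IsUltrametricDist.norm_add_le_max _ _
    exact absurd (h2.trans_lt (max_lt hlt h)) (lt_irrefl _)

/-- **KUMMER SHADOW.** If ONE interpolation point `(x,y)` of `G` lies closer to the Rubin point `(x₀,y₀)` than
CONT⁻'s lower bound `b ≤ ‖val₀‖` (`b = 2^{−n′₀}`, p694174), then `‖val₀‖ = ‖G(x,y)‖` EXACTLY: the norm of the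
out-of-range value is an in-range number. -/
theorem kummer_shadow {x₀ y₀ val₀ x y v : ℂ_[p]} (h₀ : IntSeries.HasValueAt₂ G x₀ y₀ val₀)
    (h : IntSeries.HasValueAt₂ G x y v) (hx₀ : ‖x₀‖ ≤ 1) (hy₀ : ‖y₀‖ ≤ 1) (hx : ‖x‖ ≤ 1) (hy : ‖y‖ ≤ 1)
    {b : ℝ} (hclose : max ‖x₀ - x‖ ‖y₀ - y‖ < b) (hcont : b ≤ ‖val₀‖) : ‖v‖ = ‖val₀‖ :=
  norm_eq_of_norm_sub_lt ((norm_sub_le_of_two_points h₀ h hx₀ hy₀ hx hy).trans_lt (hclose.trans_le hcont))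

end Collapse

/-! ### §B  THE TWO GHOST PRODUCERS (typed inputs + proved transfer to the Rubin value) -/

section Ghost

variable {p : ℕ} [Fact p.Prime]

/-- (Gα) input, BRANCH CONGRUENCE mod 𝔪: the `λ`- and `λω`-branches (`ω² = 1`, so `ω ≡ 1 mod 2`) of ONE
`𝐃`-valued measure are coefficientwise congruent.  PRINT-trivial on de Shalit's construction (II.4.16 (49)
with III.1.1: `μ(𝔣) ∈ Λ(𝒢, 𝐃)`); typed here as a relation between two series. -/
def BranchCongr (G G' : PowerSeries (PowerSeries (PadicComplexInt p))) : Prop :=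
  ∀ i j : ℕ, ‖((PowerSeries.coeff j (PowerSeries.coeff i G) : PadicComplexInt p) : ℂ_[p]) -
    ((PowerSeries.coeff j (PowerSeries.coeff i G') : PadicComplexInt p) : ℂ_[p])‖ < 1

/-- (Gα) packaged: some congruent sibling has an interior zero (the anchor's CENTRAL ZERO `L(W₀,1) = 0` read
on the `ω_K`-sibling branch at its 𝔭-ramified in-range point — de Shalit II.4.14 (36)–(37)). -/
def SiblingGhost (G : PowerSeries (PowerSeries (PadicComplexInt p))) : Prop :=
  ∃ (G' : PowerSeries (PowerSeries (PadicComplexInt p))) (x y : ℂ_[p]),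
    BranchCongr G G' ∧ ‖x‖ < 1 ∧ ‖y‖ < 1 ∧ IntSeries.HasValueAt₂ G' x y 0

/-- (Gβ) packaged: ONE interior value of `G` itself is a non-unit (an in-range, 𝔭-unramified, typed-range
value: de Shalit (50) = the tree's `DeShalit1987.interpolationValue`). -/
def InRangeGhost (G : PowerSeries (PowerSeries (PadicComplexInt p))) : Prop :=
  ∃ x y v : ℂ_[p], ‖x‖ < 1 ∧ ‖y‖ < 1 ∧ IntSeries.HasValueAt₂ G x y v ∧ ‖v‖ < 1

variable {G : PowerSeries (PowerSeries (PadicComplexInt p))}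

theorem norm_constTerm_lt_one_of_siblingGhost (hG : SiblingGhost G) : ‖constTerm G‖ < 1 := by
  obtain ⟨G', x, y, hcong, hx, hy, h0⟩ := hG
  have hc' : ‖constTerm G'‖ < 1 := norm_constTerm_lt_one_of_zero h0 hx hy
  have hd : ‖constTerm G - constTerm G'‖ < 1 := hcong 0 0
  have : constTerm G = (constTerm G - constTerm G') + constTerm G' := by ring
  rw [this]
  exact (IsUltrametricDist.norm_add_le_max _ _).trans_lt (max_lt hd hc')

theorem norm_constTerm_lt_one_of_inRangeGhost (hG : InRangeGhost G) : ‖constTerm G‖ < 1 := by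
  obtain ⟨x, y, v, hx, hy, h, hv⟩ := hG
  exact (norm_lt_one_iff_constTerm h hx hy).1 hv

/-- **GHOST.** Either producer makes EVERY interior value of `G` — in particular the Katz–Rubin value
`val₀ = G₂(r(γ₁⁻¹) − 1, r(γ₂⁻¹) − 1)` of the anchor's frame — a non-unit: `‖val₀‖ < 1`. -/
theorem ghost (hG : SiblingGhost G ∨ InRangeGhost G) {x₀ y₀ val₀ : ℂ_[p]}
    (hval : IntSeries.HasValueAt₂ G x₀ y₀ val₀) (hx : ‖x₀‖ < 1) (hy : ‖y₀‖ < 1) : ‖val₀‖ < 1 :=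
  (norm_lt_one_iff_constTerm hval hx hy).2
    (hG.elim norm_constTerm_lt_one_of_siblingGhost norm_constTerm_lt_one_of_inRangeGhost)

/-- Frame version of GHOST: it suffices that SOME series sharing one interior value with the frame's `G`
(another satisfier of the same frame predicate, e.g. de Shalit's own branch) has a ghost. -/
theorem ghost_of_shared {G' : PowerSeries (PowerSeries (PadicComplexInt p))} (hG' : SiblingGhost G' ∨ InRangeGhost G')
    {x y v : ℂ_[p]} (h : IntSeries.HasValueAt₂ G x y v) (h' : IntSeries.HasValueAt₂ G' x y v) (hx : ‖x‖ < 1)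
    (hy : ‖y‖ < 1) {x₀ y₀ val₀ : ℂ_[p]} (hval : IntSeries.HasValueAt₂ G x₀ y₀ val₀) (hx₀ : ‖x₀‖ < 1)
    (hy₀ : ‖y₀‖ < 1) : ‖val₀‖ < 1 :=
  (norm_lt_one_iff_constTerm hval hx₀ hy₀).2 (norm_constTerm_lt_one_of_shared_value h h' hx hy
    (hG'.elim norm_constTerm_lt_one_of_siblingGhost norm_constTerm_lt_one_of_inRangeGhost))

end Ghost

/-! ### §C  THE GLUE: GHOST ⟹ α ≥ −1 ⟹ LOWER on every member; PARITY ⟹ α = 0 (all ℤ/ℝ arithmetic) -/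

section Glue

/-- PARITY input (optional): the value lies in a DVR with uniformizer `2` (`𝐃 = 𝒪(ℚ₂^nr)^`, de Shalit
III.1.1), so its norm is an integral power of `2`. -/
def ParityAt (val : ℂ_[2]) : Prop := ∃ k : ℤ, ‖val‖ = (2 : ℝ) ^ k

/-- **GHOST ⟹ α ≥ −1.**  Member law at the anchor in squared form `‖val₀‖² = 2^{−m₀}`, `m₀ = 2(A₀+g₀)+α`,
anchor data `A₀ = 0` (BSD₂ at N = 784, Miller, + Ш[2] = 0) and `g₀ = 1` (Tam 8, tors 2, `ℓ₀ = 0`). -/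
theorem alpha_ge_neg_one_of_ghost {val : ℂ_[2]} {m A g α : ℤ} (hval : ‖val‖ ^ 2 = (2 : ℝ) ^ (-m))
    (hm : m = 2 * (A + g) + α) (hA : A = 0) (hg : g = 1) (hghost : ‖val‖ < 1) : -1 ≤ α := by
  have hsq : ‖val‖ ^ 2 < 1 := by
    have := norm_nonneg val
    nlinarith
  rw [hval, zpow_lt_one_iff_right₀ (by norm_num : (1 : ℝ) < 2)] at hsq
  omega

/-- **CONT⁻ in integer form.** `2^{−n′} ≤ ‖val‖` and `‖val‖² = 2^{−m}` give `m ≤ 2n′` (p694174's output). -/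
theorem m_le_of_cont {val : ℂ_[2]} {m n' : ℤ} (hval : ‖val‖ ^ 2 = (2 : ℝ) ^ (-m))
    (hcont : (2 : ℝ) ^ (-n') ≤ ‖val‖) : m ≤ 2 * n' := by
  have h2 : ((2 : ℝ) ^ (-n')) ^ 2 ≤ ‖val‖ ^ 2 := by
    have h0 : (0 : ℝ) ≤ (2 : ℝ) ^ (-n') := by positivity
    nlinarith
  rw [hval, ← zpow_natCast, ← zpow_mul, zpow_le_zpow_iff_right₀ (by norm_num : (1 : ℝ) < 2)] at h2
  push_cast at h2
  omega

/-- **Member step**: the member inequality `2A + 2g + α ≤ 2n′` (S2′ ∘ CONT⁻), ALG₀ `n′ = B + g` and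
`α ≥ −1` give LOWER `A ≤ B` (the integrality slack absorbs `α = −1`). -/
theorem lower_of_alpha {A B g n' α : ℤ} (hmem : 2 * A + 2 * g + α ≤ 2 * n') (hn : n' = B + g)
    (hα : -1 ≤ α) : A ≤ B := by
  omega

/-- **LOWER ON EVERY MEMBER FROM ONE BIT AT THE ANCHOR.**  `α` is key-free (STUB-PLAN §3 (x): `e_A ≡ α`);
the anchor supplies `α ≥ −1` through GHOST; every member then satisfies `A ≤ B`. -/
theorem lower_everywhere_of_ghost {ι : Type*} {val₀ : ℂ_[2]} {m₀ A₀ g₀ α : ℤ}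
    (hval₀ : ‖val₀‖ ^ 2 = (2 : ℝ) ^ (-m₀)) (hm₀ : m₀ = 2 * (A₀ + g₀) + α) (hA₀ : A₀ = 0) (hg₀ : g₀ = 1)
    (hghost : ‖val₀‖ < 1) (A B g n' : ι → ℤ) (hmem : ∀ i, 2 * A i + 2 * g i + α ≤ 2 * n' i)
    (halg : ∀ i, n' i = B i + g i) : ∀ i, A i ≤ B i := fun i ↦
  lower_of_alpha (hmem i) (halg i) (alpha_ge_neg_one_of_ghost hval₀ hm₀ hA₀ hg₀ hghost)

/-- **PARITY upgrade: the two-sided prediction `α = 0` (equivalently `η₀ = 0`, FALLBACK 0′'s input) for free.**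
GHOST + CONT⁻ (`2^{−1} ≤ ‖val₀‖`, i.e. `n′₀ = 1`) + `‖val₀‖ ∈ 2^ℤ` pin `‖val₀‖ = 1/2`, `m₀ = 2`, `α = 0`. -/
theorem alpha_eq_zero_of_parity {val : ℂ_[2]} {m α : ℤ} (hval : ‖val‖ ^ 2 = (2 : ℝ) ^ (-m))
    (hm : m = 2 + α) (hpar : ParityAt val) (hghost : ‖val‖ < 1) (hcont : (2 : ℝ) ^ (-(1 : ℤ)) ≤ ‖val‖) :
    α = 0 := by
  obtain ⟨k, hk⟩ := hpar
  have hk1 : k < 0 := by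
    rw [hk, zpow_lt_one_iff_right₀ (by norm_num : (1 : ℝ) < 2)] at hghost
    exact hghost
  have hk2 : -1 ≤ k := by
    rw [hk, zpow_le_zpow_iff_right₀ (by norm_num : (1 : ℝ) < 2)] at hcont
    exact hcont
  have hkm : 2 * k = -m := by
    rw [hk, ← zpow_natCast, ← zpow_mul] at hval
    push_cast at hval
    exact zpow_right_injective₀ (by norm_num : (0 : ℝ) < 2) (by norm_num : (2 : ℝ) ≠ 1) (by simpa [mul_comm] using hval)
  omega

/-- **(Gγ) glue: `α` EXACTLY from one in-range digit.**  KUMMER SHADOW `‖v‖ = ‖val₀‖` with the in-range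
digit `‖v‖ = 2^{−e}` and the anchor's member law give `α = 2e − 2(A₀+g₀)` (`= 2e − 2` at `cm7^{(−1)}`):
the `α`-AUDIT relocated from the Rubin point (R140 / a₀ / γ₀, beyond print) to ONE typed interpolation value. -/
theorem alpha_eq_of_shadow {val₀ v : ℂ_[2]} {m₀ A₀ g₀ α e : ℤ} (hval₀ : ‖val₀‖ ^ 2 = (2 : ℝ) ^ (-m₀))
    (hm₀ : m₀ = 2 * (A₀ + g₀) + α) (hshadow : ‖v‖ = ‖val₀‖) (he : ‖v‖ = (2 : ℝ) ^ (-e)) :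
    α = 2 * e - 2 * (A₀ + g₀) := by
  rw [hshadow] at he
  rw [he, ← zpow_natCast, ← zpow_mul] at hval₀
  push_cast at hval₀
  have h := zpow_right_injective₀ (by norm_num : (0 : ℝ) < 2) (by norm_num : (2 : ℝ) ≠ 1)
    (by simpa [mul_comm] using hval₀ : (2 : ℝ) ^ (-e * 2) = (2 : ℝ) ^ (-m₀))
  omega

/-- (Gγ) ⟹ LOWER: with the shadow digit `e ≥ 1` (i.e. GHOST read exactly) every member closes. -/
theorem lower_everywhere_of_shadow {ι : Type*} {val₀ v : ℂ_[2]} {m₀ A₀ g₀ α e : ℤ}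
    (hval₀ : ‖val₀‖ ^ 2 = (2 : ℝ) ^ (-m₀)) (hm₀ : m₀ = 2 * (A₀ + g₀) + α) (hA₀ : A₀ = 0) (hg₀ : g₀ = 1)
    (hshadow : ‖v‖ = ‖val₀‖) (he : ‖v‖ = (2 : ℝ) ^ (-e)) (he1 : 1 ≤ e) (A B g n' : ι → ℤ)
    (hmem : ∀ i, 2 * A i + 2 * g i + α ≤ 2 * n' i) (halg : ∀ i, n' i = B i + g i) : ∀ i, A i ≤ B i := by
  have hα := alpha_eq_of_shadow hval₀ hm₀ hshadow he
  intro i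
  exact lower_of_alpha (hmem i) (halg i) (by omega)

/-- **rpow currency of D3 (row 57, k3-g19 `lower_of_norm_sandwich`'s `hval`).**  S2′-L₀ in norm form
`‖val_W‖ = 2^{−x_W − α/2}` (`x_W = A_W + g_W`) with `α ≥ −1` gives the B28-strict bound `‖val_W‖ ≤ 2^{1/2 − x_W}`. -/
theorem d3_of_alpha {r : ℝ} {x α : ℤ} (hlaw : r = (2 : ℝ) ^ (-(x : ℝ) - (α : ℝ) / 2)) (hα : -1 ≤ α) :
    r ≤ (2 : ℝ) ^ ((1 : ℝ) / 2 - (x : ℝ)) := by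
  rw [hlaw]
  refine Real.rpow_le_rpow_of_exponent_le (by norm_num : (1 : ℝ) ≤ 2) ?_
  have : ((-1 : ℤ) : ℝ) ≤ (α : ℝ) := Int.cast_le.mpr hα
  push_cast at this
  linarith

/-- GHOST in rpow currency: at the anchor `x₀ = A₀ + g₀ = 1`, `‖val₀‖ = 2^{−1 − α/2} < 1` forces `α ≥ −1`. -/
theorem alpha_ge_neg_one_of_ghost_rpow {r : ℝ} {x₀ α : ℤ} (hlaw : r = (2 : ℝ) ^ (-(x₀ : ℝ) - (α : ℝ) / 2))
    (hx₀ : x₀ = 1) (hghost : r < 1) : -1 ≤ α := by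
  rw [hlaw, hx₀] at hghost
  have h1 : (2 : ℝ) ^ (-((1 : ℤ) : ℝ) - (α : ℝ) / 2) < (2 : ℝ) ^ (0 : ℝ) := by rwa [Real.rpow_zero]
  have h2 := (Real.rpow_lt_rpow_left_iff (by norm_num : (1 : ℝ) < 2)).mp h1
  push_cast at h2
  have h3 : ((-2 : ℤ) : ℝ) < (α : ℝ) := by push_cast; linarith
  have h4 : (-2 : ℤ) < α := Int.cast_lt.mp h3
  omega

/-- The k3-g19 sandwich (row 57 §E), re-proved inline so that this file is self-contained:
CONT⁻ `2^{−n′} ≤ ‖val‖`, D3 `‖val‖ ≤ 2^{1/2 − x}`, ALG₀ `n′ = B + g`, `x = A + g` ⟹ `A ≤ B`. -/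
theorem lower_of_norm_sandwich' {A B g n' x : ℤ} {r : ℝ}
    (hcont : (2 : ℝ) ^ (-(n' : ℝ)) ≤ r) (hval : r ≤ (2 : ℝ) ^ ((1 : ℝ) / 2 - (x : ℝ)))
    (halg : n' = B + g) (hx : x = A + g) : A ≤ B := by
  have h := le_trans hcont hval
  have h' : (-(n' : ℝ)) ≤ (1 : ℝ) / 2 - (x : ℝ) :=
    (Real.rpow_le_rpow_left_iff (by norm_num : (1 : ℝ) < 2)).mp h
  have hlt : ((x : ℤ) : ℝ) < ((n' + 1 : ℤ) : ℝ) := by push_cast; linarith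
  have hlt' : x < n' + 1 := Int.cast_lt.mp hlt
  omega

/-- **THE WHOLE LOWER PATH FROM ONE BIT (rpow currency, every member).**  Anchor GHOST ⟹ `α ≥ −1` ⟹ D3 on
each member ⟹ sandwich ⟹ `A_W ≤ B_W`. Inputs per member: S2′-L₀ law, CONT⁻, ALG₀; at the anchor: law + GHOST. -/
theorem lower_path_of_ghost {ι : Type*} {r₀ : ℝ} {x₀ α : ℤ}
    (hlaw₀ : r₀ = (2 : ℝ) ^ (-(x₀ : ℝ) - (α : ℝ) / 2)) (hx₀ : x₀ = 1) (hghost : r₀ < 1)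
    (r : ι → ℝ) (A B g n' x : ι → ℤ) (hlaw : ∀ i, r i = (2 : ℝ) ^ (-(x i : ℝ) - (α : ℝ) / 2))
    (hcont : ∀ i, (2 : ℝ) ^ (-(n' i : ℝ)) ≤ r i) (halg : ∀ i, n' i = B i + g i)
    (hx : ∀ i, x i = A i + g i) : ∀ i, A i ≤ B i := fun i ↦
  lower_of_norm_sandwich' (hcont i) (d3_of_alpha (hlaw i) (alpha_ge_neg_one_of_ghost_rpow hlaw₀ hx₀ hghost))
    (halg i) (hx i)

end Glue

/-! ### §D  ANCHOR DIGIT `ℓ₀ = 0`: the 2-adic brick (odd valuation ⟹ not a square) -/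

section AnchorDigit

/-- In `ℚ₂` an element of odd valuation is not a square — the brick behind `ℓ₀ = 0` at the anchor
`W₀ : y² = x³ − 21x² + 112x`, `P₀ = (8,8)`: `x(P₀) = 8`, `x(P₀+(0,0)) = 14`, and for the other two 2-torsion
points one of `x(P₀+T) − e` has valuation `1` or `3`, so `P₀ ∉ 2W₀(ℚ₂) + W₀(ℚ₂)_tors` (tree:
`isSquare_x_sub_of_two_nsmul_eq`), hence `log_ω P₀ ∈ ℤ₂ˣ` (`range_padicLog_cellTwist_two` on key (1,7)). -/
theorem not_isSquare_of_norm_eq_two_zpow_odd (a : ℚ_[2]) (k : ℤ) (ha : ‖a‖ = (2 : ℝ) ^ (2 * k + 1)) :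
    ¬ IsSquare a := by
  rintro ⟨z, rfl⟩
  have hz : z ≠ 0 := by
    rintro rfl
    have : (0 : ℝ) < (2 : ℝ) ^ (2 * k + 1) := by positivity
    simp at ha
    linarith
  rw [norm_mul, Padic.norm_eq_zpow_neg_valuation hz, ← zpow_add₀ (by norm_num : ((2 : ℕ) : ℝ) ≠ 0)] at ha
  have h := zpow_right_injective₀ (by norm_num : (0 : ℝ) < 2) (by norm_num : (2 : ℝ) ≠ 1)
    (by simpa using ha : (2 : ℝ) ^ (-z.valuation + -z.valuation) = (2 : ℝ) ^ (2 * k + 1))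
  omega

/-- `8` and `14 = 112/8` are not squares in `ℚ₂` (`x(P₀)` and `x(P₀ + (0,0))`). -/
theorem not_isSquare_eight : ¬ IsSquare (8 : ℚ_[2]) := by
  refine not_isSquare_of_norm_eq_two_zpow_odd 8 (-2) ?_
  have h : (8 : ℚ_[2]) = ((2 : ℚ_[2])) ^ 3 := by norm_num
  have h2 : ‖(2 : ℚ_[2])‖ = (2 : ℝ)⁻¹ := by
    have := @Padic.norm_p 2 _
    simpa using this
  rw [h, norm_pow, h2]
  norm_num

/-- **EVEN-SHIFT DEPTH (the metric input of the Kummer shadow at 2).**  A unit of `ℤ₂` squares into `1 + 8ℤ₂`;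
hence two characters on one branch whose infinity types differ by EVEN integers (`ψ₄₉^{2a} ψ̄₄₉^{2b}`, trivial
on `Δ` since `κᵢ(Δ) ⊆ {±1}`) have Γ-coordinates at distance `≤ 1/8 < 1/2 = 2^{−n′₀}`. -/
theorem norm_sq_sub_one_le_of_norm_eq_one (z : ℤ_[2]) (hz : ‖z‖ = 1) :
    ‖z ^ 2 - 1‖ ≤ ((2 : ℕ) : ℝ) ^ (-(3 : ℕ) : ℤ) := by
  rw [PadicInt.norm_le_pow_iff_mem_span_pow]
  have hk : z ^ 2 - 1 ∈ RingHom.ker (PadicInt.toZModPow 3 : ℤ_[2] →+* ZMod (2 ^ 3)) := by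
    rw [RingHom.mem_ker, map_sub, map_pow, map_one]
    obtain ⟨u, hu⟩ := (PadicInt.isUnit_iff.mpr hz).map (PadicInt.toZModPow 3 : ℤ_[2] →+* ZMod (2 ^ 3))
    rw [← hu]
    have key : ∀ a b : ZMod (2 ^ 3), a * b = 1 → a ^ 2 - 1 = 0 := by decide
    exact key _ _ u.mul_inv
  rwa [PadicInt.ker_toZModPow] at hk

/-- Corollary: `‖u^{2a} − 1‖ ≤ 1/8` for every `u ∈ ℤ₂ˣ`, `a ∈ ℕ`. -/
theorem norm_pow_two_mul_sub_one_le (u : ℤ_[2]) (hu : ‖u‖ = 1) (a : ℕ) :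
    ‖u ^ (2 * a) - 1‖ ≤ ((2 : ℕ) : ℝ) ^ (-(3 : ℕ) : ℤ) := by
  rw [mul_comm, pow_mul]
  exact norm_sq_sub_one_le_of_norm_eq_one (u ^ a) (by rw [norm_pow, hu, one_pow])

end AnchorDigit

end Summit.BirchSwinnertonDyer.BirchSwinnertonDyer.Cruxes.SplitBadTwoLowerHalfOfFacts.GhostZeroK3G20

end
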